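import Summits.HodgeConjecture.HodgeConjecture.Theorems.Ring2AbelianAllWeilCellsBlochSeed
import Literature.AlgebraicGeometry.VanGeemen1994.WeilDiscriminantOfHyperbolic
import HarnessLib

/-!
# Ring 2 · AbelianAll (ab-weil-1, gen 13, part 11) — the discriminant class is a COMPLETE INVARIANT of
  Weil-similarity: `IsWeilSimilar ⟹ same δ` (the converse of part 8f/8g), so the cells `(n, d, δ)` ARE the
  Weil-similarity classes, and hweil's door B′ is re-indexed by cells EXACTLY

research route, not a corollary; conditional on HC_CM plus one named minimal statement.
Cell line: research route conditional on HC_CM; not a corollary; Q11.4-sentence-2 already refuted in dim ≥ 3.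
`HC_CM` (`Theses.RankFourFaces.CMAbelianHodge`) does not occur in this file and no open case of the Hodge
conjecture is claimed.  Nothing here is new mathematics: §1 is linear algebra on the carriers (a `K`-linear
similitude of rational `H¹`'s carries Gram witnesses to Gram witnesses), §2 composes it with the Literature's
uniqueness of the class (van Geemen 5.2 (3)), §3–§4 are bookkeeping over parts 8g / 10 and hweil's predicates.

## What this part adds (and why)

Parts 8f/8g proved ONE direction of van Geemen 5.2 (3)–(4) / Deligne, proof of 4.8, on the carriers: two
polarized Weil-type triples `(A, φ, h_K)`, `(A', φ', h'_K)` with non-degenerate Gram witnesses of the SAME class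
`δ ∈ ℚ^×/Nm(K_d^×)` are `Motives.IsWeilSimilar`.  The CONVERSE — Weil-similar triples have the same class — was
named but not claimed (gen 12, AW1.78).  It is the statement that makes "the cell `(n, d, δ)`" and "the
Weil-similarity class" the same thing, i.e. that the seat's per-cell nodes (N77 `HasLocallyAlgebraicWeilAnchorInClass`,
N80 `HasBlochSeedInClass`) and hweil's per-similarity-class predicates (`HasSimilarLocallyAlgebraicWeilAnchors`,
`HasSimilarBlochSeeds`) index the same partition.  This file proves it:

* §1 `hasWeilDiscriminantNondeg_of_isWeilSimilar` — TRANSPORT: if `(P, ψ, h_P) ~ (A, φ, h_A)` (`IsWeilSimilar n`,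
  `dim P = dim A = 2n ≥ 2`) then every non-degenerate Gram witness of class `δ` for `(P, ψ, h_P)` yields one of
  class `δ` for `(A, φ, h_A)` (ANY polarization classes, any `d`): the rational frames `u`, `v` of the similarity
  are `ℚ`-bases of `H¹(·, ℚ) ⊗ ℂ` (`b₁ = 4n`), `T : uᵢ ↦ vᵢ` is a `ℂ`-linear isomorphism defined over `ℚ`
  (`repr_mem_range_ratCast_of_isRationalClass`) with `T ψ^* = φ^* T` (same matrix `M`) and
  `Q_{h_A}(T x, T y) = s · ω_A` whenever `Q_{h_P}(x, y) = s · ω_P` (same Gram matrix `G`); the witness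
  `(x, ω, a, b, q)` goes to `(T x, λ ω_A, a, b, q)` where `ω = λ ω_P`, `λ ∈ ℚ^×` (`H^{4n}` is a line).
* §2 `weilDiscriminantClass_eq_of_isWeilSimilar` — hence, when the target class is `K`-symmetrised
  (`h_K = d·e^*a + φ^*e^*a`, where the Literature's `hasWeilDiscriminantNondeg_ksymm_unique` applies), similar
  triples have EQUAL classes; with part 8g, `isWeilSimilar_iff_weilDiscriminantClass_eq` (Weil type on both sides):
  `IsWeilSimilar ⟺ δ = δ'`.  Corollaries: similarity is transitive on Weil-type `K`-symmetrised triples; triples of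
  different classes are not similar (the cells are separated).
* §3 CELL MEMBERSHIP IS SIMILARITY-INVARIANT: a Bloch seed (resp. a locally algebraic anchor) on ANY `(P, ψ₀, h_K)`
  Weil-similar to a member of the cell `δ` files N80 `δ` (resp. N77 `δ`) — the form in which hweil's door-B′ output
  feeds the seat's nodes.
* §4 THE EXACT RE-INDEXING OF DOOR B′ (count once with hweil, now an `iff`): `HasSimilarBlochSeeds n d ⟺` "every
  target `(A, φ)` has SOME `K`-symmetrised polarization whose cell satisfies N80", and the same for anchors /
  N77 (`hasSimilarBlochSeeds_iff_exists_polarization_seedInClass`,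
  `hasSimilarLocallyAlgebraicWeilAnchors_iff_exists_polarization_anchorInClass`).  So hweil's B′ sits between the
  seat's `∀ δ, N80 δ` (part 10, W70: `⟹ B′`) and the per-target form; the residual difference is exactly WHICH
  polarizations' cells must carry a seed (B′ lets the polarization of the target float) — recorded, not claimed away.

Every Bloch citation below means: Bloch (7.4) as re-proved by Buchweitz–Flenner 2003, Thm. 5.2, and Voisin,
LNM 1594, Lecture 7, Thm. 2.4 (the refereed inputs behind hweil's `BlochSemiregularSpread`).
[cite: vanGeemen1994HodgeAV, Lemma 5.2 (3)–(4) and Thm. 5.3] [cite: Deligne1982HodgeCycles, Prop. 4.1 and proof of Thm. 4.8]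
[cite: Bloch1972Semiregularity, Thm. (7.4) and Remark (7.5)] [cite: BuchweitzFlenner2003, Thm. 5.2]

## References

* [vanGeemen1994HodgeAV] B. van Geemen, An introduction to the Hodge conjecture for abelian varieties, LNM 1594
  (1994): 4.14, Lemma 5.2 (1)–(4), Thm. 5.3, 5.4.
* [Deligne1982HodgeCycles] P. Deligne, Hodge cycles on abelian varieties, LNM 900 (1982): Prop. 4.1 (Landherr),
  Lemma 4.6, proof of Thm. 4.8 (pp. 47–52), Remark 4.9.
* [Landherr1936HermitianForms] W. Landherr, Abh. Math. Sem. Hamburg 11 (1936).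
* [Bloch1972Semiregularity] S. Bloch, Semi-regularity and de Rham cohomology, Invent. Math. 17 (1972), Thm. (7.4),
  Remark (7.5).
* [BuchweitzFlenner2003] R.-O. Buchweitz, H. Flenner, A semiregularity map for modules and applications to
  deformations, Compositio Math. 137 (2003), Thm. 5.2.
* [VoisinTorino1994] C. Voisin, LNM 1594, Lecture 7, Thm. 2.4.
* [Schoen1998HodgeWeilAddendum] C. Schoen, Addendum, Compositio Math. 114 (1998), §10.
* [HatcherAT2002] A. Hatcher, Algebraic Topology (2002), §3.1 (rational coordinates), Cor. 3.37.
-/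

set_option linter.dupNamespace false

noncomputable section

open CategoryTheory AlgebraicGeometry
open Literature.AlgebraicGeometry Literature.AlgebraicGeometry.Motives
open Literature.AlgebraicGeometry.HodgeTheory
open Literature.AlgebraicGeometry.VanGeemen1994
open Literature.AlgebraicTopology.SingularHomology
open Summit.HodgeConjecture.HodgeConjecture.Ring2.Hypotheses

namespace Summit.HodgeConjecture.HodgeConjecture.Ring2.AbelianAll

/-! ### §1 Transport of Gram witnesses along a Weil-similarity -/

/-- **Weil-similar triples have Gram witnesses of the same class (TRANSPORT).**  Let `(P, ψ, h_P)` and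
`(A, φ, h_A)` be Weil-similar in half-dimension `n ≥ 1` (`Motives.IsWeilSimilar`), `dim P = dim A = 2n`.  Then a
non-degenerate Gram witness of class `δ` for `(P, ψ, h_P)` (`HasWeilDiscriminantNondeg`: a rational frame
`x₁ … x₂ₙ` with `{xᵢ, ψ^*xᵢ}` independent, `Q_{h_P}(xᵢ, ψ^*xⱼ) = aᵢⱼ ω`, `Q_{h_P}(xᵢ, xⱼ) = bᵢⱼ ω`,
`det Ψ(a, b) = q`, `[q] = δ`) yields one for `(A, φ, h_A)`: the frames `u`, `v` of the similarity are rational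
`ℚ`-bases of `H¹ ⊗ ℂ` (`b₁ = 4n`, `AbelianVariety.finrank_complexBetti_one`), the `ℂ`-isomorphism `T : uᵢ ↦ vᵢ`
is defined over `ℚ` (rational classes have rational coordinates in a rational basis), intertwines `ψ^*` with `φ^*`
(one matrix `M`) and carries `Q_{h_P}` to `Q_{h_A}` relative to `ω_P ↦ ω_A` (one Gram matrix `G`); writing the
witness's top class as `ω = λ ω_P` with `λ ∈ ℚ^×` (`H^{4n}(P; ℂ)` is a line spanned by rational classes), the
transported witness is `(T x, λ ω_A, a, b, q)` — same matrices, same `q`, same class.  No hypothesis on the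
polarization classes or on `d`.  This is Deligne's remark that the marking `k₁` of the PEL datum is a
`K`-linear similitude, read on the carriers. [cite: Deligne1982HodgeCycles, proof of Thm. 4.8 (p. 48) and Lemma 4.6]
[cite: vanGeemen1994HodgeAV, Lemma 5.2 (3)] [cite: HatcherAT2002, §3.1 Thm. 3.2 and Cor. 3.37] -/
theorem hasWeilDiscriminantNondeg_of_isWeilSimilar {P A : AbelianVariety ℂ} {ψ : P ⟶ P} {φ : A ⟶ A} {n d : ℕ}
    {hP : complexBetti P.X 2} {hA : complexBetti A.X 2} (hn : 0 < n) (hPdim : P.dim = 2 * n)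
    (hAdim : A.dim = 2 * n) (hsim : Motives.IsWeilSimilar n P ψ hP A φ hA) {δ : weilNormResidueGroup d}
    (hδ : HasWeilDiscriminantNondeg P ψ n d hP δ) : HasWeilDiscriminantNondeg A φ n d hA δ := by
  classical
  obtain ⟨u, v, M, G, ωP, ωA, hu, hui, hv, hvi, hMu, hMv, hωP, hωP0, hωA, hωA0, hGu, hGv⟩ := hsim
  obtain ⟨x, ω, am, bm, q, hx, hind, hω, hω0, hQ, hdet, hq⟩ := hδ
  haveI : Nonempty (Fin (4 * n)) := ⟨⟨0, by omega⟩⟩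
  -- `u`, `v` are bases of `H¹` (`b₁ = 4n`)
  have hcardP : Fintype.card (Fin (4 * n)) = Module.finrank ℂ (complexBetti P.X 1) := by
    rw [Fintype.card_fin, AbelianVariety.finrank_complexBetti_one, hPdim]; ring
  have hcardA : Fintype.card (Fin (4 * n)) = Module.finrank ℂ (complexBetti A.X 1) := by
    rw [Fintype.card_fin, AbelianVariety.finrank_complexBetti_one, hAdim]; ring
  let bu : Module.Basis (Fin (4 * n)) ℂ (complexBetti P.X 1) := basisOfLinearIndependentOfCardEqFinrank hui hcardP
  let bv : Module.Basis (Fin (4 * n)) ℂ (complexBetti A.X 1) := basisOfLinearIndependentOfCardEqFinrank hvi hcardA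
  have hbu : ∀ i, bu i = u i := fun i => by simp [bu]
  have hbv : ∀ i, bv i = v i := fun i => by simp [bv]
  -- the transport `T : uᵢ ↦ vᵢ`, a `ℂ`-linear isomorphism `H¹(P; ℂ) ≃ H¹(A; ℂ)`
  let T : complexBetti P.X 1 ≃ₗ[ℂ] complexBetti A.X 1 := bu.equiv bv (Equiv.refl _)
  have hT : ∀ i, T (u i) = v i := fun i => by
    rw [← hbu, Module.Basis.equiv_apply, Equiv.refl_apply, hbv]
  -- `T` intertwines `ψ^*` and `φ^*` (same matrix `M`)
  have hTψ : ∀ z, T (complexBetti.map ψ.hom.hom.hom 1 z) = complexBetti.map φ.hom.hom.hom 1 (T z) := by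
    intro z
    conv_lhs => rw [← bu.sum_repr z]
    conv_rhs => rw [← bu.sum_repr z]
    simp only [map_sum, map_smul, hbu, hMu, hT, hMv]
  -- `T` preserves rational classes (rational coordinates in the rational basis `u`)
  have hbur : ∀ i, IsRationalClass (bu i) := fun i => by rw [hbu]; exact hu i
  have hTrat : ∀ z, IsRationalClass z → IsRationalClass (T z) := by
    intro z hz
    rw [← bu.sum_repr z, map_sum]
    refine isRationalClass_sum _ _ fun i _ => ?_
    obtain ⟨c, hc⟩ := repr_mem_range_ratCast_of_isRationalClass bu hbur hz i
    rw [map_smul, ← hc, hbu, hT]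
    exact (hv i).smul c
  -- `T` carries `Q_{h_P}` to `Q_{h_A}` relative to `ω_P ↦ ω_A` (same Gram matrix `G`)
  have hexpP : ∀ y z, polarizationPairingOne P.X hP (2 * n - 1) y z =
      (∑ i, bu.repr y i * ∑ j, bu.repr z j * ((G i j : ℚ) : ℂ)) • ωP := by
    intro y z
    conv_lhs => rw [← bu.sum_repr y, ← bu.sum_repr z]
    simp only [map_sum, map_smul, LinearMap.sum_apply, LinearMap.smul_apply, hbu, hGu, smul_smul,
      Finset.sum_smul, Finset.mul_sum]
    simp only [Finset.smul_sum, smul_smul]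
    conv_lhs => rw [Finset.sum_comm]
    exact Finset.sum_congr rfl fun a _ => Finset.sum_congr rfl fun b _ => by rw [mul_left_comm]
  have hexpA : ∀ y z, polarizationPairingOne A.X hA (2 * n - 1) (T y) (T z) =
      (∑ i, bu.repr y i * ∑ j, bu.repr z j * ((G i j : ℚ) : ℂ)) • ωA := by
    intro y z
    conv_lhs => rw [← bu.sum_repr y, ← bu.sum_repr z]
    simp only [map_sum, map_smul, hbu, hT, LinearMap.sum_apply, LinearMap.smul_apply, hGv, smul_smul,
      Finset.sum_smul, Finset.mul_sum]
    simp only [Finset.smul_sum, smul_smul]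
    conv_lhs => rw [Finset.sum_comm]
    exact Finset.sum_congr rfl fun a _ => Finset.sum_congr rfl fun b _ => by rw [mul_left_comm]
  have hpair : ∀ (y z : complexBetti P.X 1) (s : ℂ), polarizationPairingOne P.X hP (2 * n - 1) y z = s • ωP →
      polarizationPairingOne A.X hA (2 * n - 1) (T y) (T z) = s • ωA := by
    intro y z s hs
    rw [hexpP] at hs
    rw [hexpA, smul_left_injective ℂ hωP0 hs]
  -- the top classes: `ω = λ • ω_P` with `λ ∈ ℚ^×` (`H^{4n}(P; ℂ)` is a line)
  have hP' : P.dim = 2 * n - 1 + 1 := by omega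
  have hX : IsSmoothProjective (2 * n - 1 + 1) P.X := Motives.isSmoothProjective_of_dim_eq' hP'
  have h1 := Motives.finrank_complexBetti_two_add_two_mul_eq_one hX
  obtain ⟨lam, hlam⟩ := Motives.exists_eq_ratCast_smul_of_finrank_eq_one h1 hωP hωP0 hω
  have hlam0 : lam ≠ 0 := by
    rintro rfl
    exact hω0 (by rw [hlam, Rat.cast_zero, zero_smul])
  -- THE TRANSPORTED WITNESS `(T x, λ ω_A, a, b, q)`
  refine ⟨fun i => T (x i), ((lam : ℚ) : ℂ) • ωA, am, bm, q, fun i => hTrat _ (hx i), ?_, hωA.smul lam,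
    smul_ne_zero (by exact_mod_cast hlam0) hωA0, fun i j => ⟨?_, ?_⟩, hdet, hq⟩
  · -- independence of `{T xᵢ, φ^* T xᵢ} = T {xᵢ, ψ^* xᵢ}`
    have hfun : Sum.elim (fun i => T (x i)) (fun i => complexBetti.map φ.hom.hom.hom 1 (T (x i))) =
        T ∘ Sum.elim x (fun i => complexBetti.map ψ.hom.hom.hom 1 (x i)) := by
      funext s
      rcases s with i | i
      · rfl
      · exact (hTψ (x i)).symm
    rw [hfun]
    exact hind.map' T.toLinearMap T.ker
  · rw [← hTψ, hpair _ _ (((am i j : ℚ) : ℂ) * ((lam : ℚ) : ℂ)) (by rw [(hQ i j).1, hlam, smul_smul]), smul_smul]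
  · rw [hpair _ _ (((bm i j : ℚ) : ℂ) * ((lam : ℚ) : ℂ)) (by rw [(hQ i j).2, hlam, smul_smul]), smul_smul]

/-- **Weil-similar triples lie in the same cells** (`iff` form of the transport, by symmetry of
`IsWeilSimilar`). [cite: Deligne1982HodgeCycles, proof of Thm. 4.8 (p. 48)] [cite: vanGeemen1994HodgeAV, Lemma 5.2 (3)] -/
theorem hasWeilDiscriminantNondeg_iff_of_isWeilSimilar {P A : AbelianVariety ℂ} {ψ : P ⟶ P} {φ : A ⟶ A}
    {n d : ℕ} {hP : complexBetti P.X 2} {hA : complexBetti A.X 2} (hn : 0 < n) (hPdim : P.dim = 2 * n)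
    (hAdim : A.dim = 2 * n) (hsim : Motives.IsWeilSimilar n P ψ hP A φ hA) (δ : weilNormResidueGroup d) :
    HasWeilDiscriminantNondeg P ψ n d hP δ ↔ HasWeilDiscriminantNondeg A φ n d hA δ :=
  ⟨hasWeilDiscriminantNondeg_of_isWeilSimilar hn hPdim hAdim hsim,
    hasWeilDiscriminantNondeg_of_isWeilSimilar hn hAdim hPdim hsim.symm⟩

/-! ### §2 The class is a complete invariant of Weil-similarity -/

/-- **`IsWeilSimilar ⟹ same discriminant class`** (the converse of part 8f/8g; van Geemen 5.2 (3): the class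
`det H ∈ ℚ^×/Nm(K^×)` is an invariant of the similarity class of the `K`-Hermitian form).  For `(P, ψ, h_P)` with
ANY polarization class and a target `(A, φ, h_K)` with `φ ≫ φ = -d` and `K`-SYMMETRISED class
`h_K = d·e^*a + φ^*e^*a` (`a` rational; the regime of the Literature's uniqueness theorem
`hasWeilDiscriminantNondeg_ksymm_unique`), `dim P = dim A = 2n ≥ 2`, `d ≥ 1`: if the triples are Weil-similar,
every witness class of `(P, ψ, h_P)` equals every witness class of `(A, φ, h_K)`.
[cite: vanGeemen1994HodgeAV, Lemma 5.2 (3)] [cite: Deligne1982HodgeCycles, Prop. 4.1 and proof of Thm. 4.8] -/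
theorem weilDiscriminantClass_eq_of_isWeilSimilar {P A : AbelianVariety ℂ} {ψ : P ⟶ P} {φ : A ⟶ A} {n d : ℕ}
    {hP : complexBetti P.X 2} (hn : 0 < n) (hd : 0 < d) (hPdim : P.dim = 2 * n) (hAdim : A.dim = 2 * n)
    (hφ : φ ≫ φ = -(d • 𝟙 A)) (e : ProjectiveEmbedding A.X) {a : complexBetti (projectiveSpace e.n ℂ) 2}
    (haQ : IsRationalClass a)
    (hsim : Motives.IsWeilSimilar n P ψ hP A φ
      ((d : ℂ) • complexBetti.map e.ι 2 a + complexBetti.map φ.hom.hom.hom 2 (complexBetti.map e.ι 2 a)))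
    {δ δ' : weilNormResidueGroup d} (hδ : HasWeilDiscriminantNondeg P ψ n d hP δ)
    (hδ' : HasWeilDiscriminantNondeg A φ n d
      ((d : ℂ) • complexBetti.map e.ι 2 a + complexBetti.map φ.hom.hom.hom 2 (complexBetti.map e.ι 2 a)) δ') :
    δ = δ' :=
  hasWeilDiscriminantNondeg_ksymm_unique hn hAdim hd hφ e haQ
    (hasWeilDiscriminantNondeg_of_isWeilSimilar hn hPdim hAdim hsim hδ) hδ'

/-- **Cells = Weil-similarity classes.**  For two polarized triples `(A, φ, h_K)`, `(A', φ', h'_K)` of Weil type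
`(n, d)` with `K`-symmetrised hyperplane classes (`a, a'` rational and non-zero) and non-degenerate Gram witnesses of
classes `δ`, `δ'`: `IsWeilSimilar n (A, φ, h_K) (A', φ', h'_K) ⟺ δ = δ'`.  `⟸` is part 8g
(`isWeilSimilar_of_hasWeilDiscriminantNondeg`: van Geemen 5.2 (4) + Landherr, standard frames realising a common
Gram matrix); `⟹` is §1 + the Literature's uniqueness of the class.  The invariants `(n, K_d, δ)` thus classify
polarized Weil-type rational `H¹`'s up to `K`-linear similitude, on the carriers — van Geemen's Thm. 5.3
("polarized abelian varieties of Weil type of dimension `2n` with given `(K, det H)` form an `n²`-dimensional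
family") read as a statement about the INDEX SET of the cells. [cite: vanGeemen1994HodgeAV, Lemma 5.2 (3)–(4) and Thm. 5.3]
[cite: Deligne1982HodgeCycles, Prop. 4.1 and proof of Thm. 4.8] [cite: Landherr1936HermitianForms] -/
theorem isWeilSimilar_iff_weilDiscriminantClass_eq {A A' : AbelianVariety ℂ} {φ : A ⟶ A} {φ' : A' ⟶ A'}
    {n d : ℕ} (hW : IsWeilType A φ n d) (hW' : IsWeilType A' φ' n d)
    (e : ProjectiveEmbedding A.X) {a : complexBetti (projectiveSpace e.n ℂ) 2} (haQ : IsRationalClass a)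
    (ha0 : a ≠ 0) (e' : ProjectiveEmbedding A'.X) {a' : complexBetti (projectiveSpace e'.n ℂ) 2}
    (ha'Q : IsRationalClass a') (ha'0 : a' ≠ 0) {δ δ' : weilNormResidueGroup d}
    (hδ : HasWeilDiscriminantNondeg A φ n d
      ((d : ℂ) • complexBetti.map e.ι 2 a + complexBetti.map φ.hom.hom.hom 2 (complexBetti.map e.ι 2 a)) δ)
    (hδ' : HasWeilDiscriminantNondeg A' φ' n d
      ((d : ℂ) • complexBetti.map e'.ι 2 a' + complexBetti.map φ'.hom.hom.hom 2 (complexBetti.map e'.ι 2 a')) δ') :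
    Motives.IsWeilSimilar n A φ
        ((d : ℂ) • complexBetti.map e.ι 2 a + complexBetti.map φ.hom.hom.hom 2 (complexBetti.map e.ι 2 a)) A' φ'
        ((d : ℂ) • complexBetti.map e'.ι 2 a' + complexBetti.map φ'.hom.hom.hom 2 (complexBetti.map e'.ι 2 a')) ↔
      δ = δ' := by
  refine ⟨fun hsim => weilDiscriminantClass_eq_of_isWeilSimilar hW.pos hW.d_pos hW.dim_eq hW'.dim_eq hW'.sq_eq e'
    ha'Q hsim hδ hδ', ?_⟩
  rintro rfl
  exact isWeilSimilar_of_hasWeilDiscriminantNondeg hW hW' e haQ ha0 e' ha'Q ha'0 hδ hδ'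

/-- **The cells are separated**: Weil-type `K`-symmetrised triples with witnesses of DIFFERENT classes are not
Weil-similar (no PEL family of the one reaches the other). [cite: vanGeemen1994HodgeAV, Lemma 5.2 (3) and Thm. 5.3] -/
theorem not_isWeilSimilar_of_weilDiscriminantClass_ne {A A' : AbelianVariety ℂ} {φ : A ⟶ A} {φ' : A' ⟶ A'}
    {n d : ℕ} (hW : IsWeilType A φ n d) (hW' : IsWeilType A' φ' n d) {hK : complexBetti A.X 2}
    (e' : ProjectiveEmbedding A'.X) {a' : complexBetti (projectiveSpace e'.n ℂ) 2} (ha'Q : IsRationalClass a')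
    {δ δ' : weilNormResidueGroup d} (hδ : HasWeilDiscriminantNondeg A φ n d hK δ)
    (hδ' : HasWeilDiscriminantNondeg A' φ' n d
      ((d : ℂ) • complexBetti.map e'.ι 2 a' + complexBetti.map φ'.hom.hom.hom 2 (complexBetti.map e'.ι 2 a')) δ')
    (hne : δ ≠ δ') :
    ¬ Motives.IsWeilSimilar n A φ hK A' φ'
        ((d : ℂ) • complexBetti.map e'.ι 2 a' + complexBetti.map φ'.hom.hom.hom 2 (complexBetti.map e'.ι 2 a')) :=
  fun hsim => hne (weilDiscriminantClass_eq_of_isWeilSimilar hW.pos hW.d_pos hW.dim_eq hW'.dim_eq hW'.sq_eq e' ha'Q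
    hsim hδ hδ')

/-- **Weil-similarity is transitive on Weil-type `K`-symmetrised triples** (through the invariant `δ`: each triple
has a witness class, van Geemen 5.2 (1)–(3) = the Literature's `exists_hasWeilDiscriminantNondeg`; similar triples
share it, §2; equal classes are similar, part 8g). [cite: vanGeemen1994HodgeAV, Lemma 5.2 (1)–(4)]
[cite: Deligne1982HodgeCycles, proof of Thm. 4.8] -/
theorem isWeilSimilar_trans_ksymm {A A' A'' : AbelianVariety ℂ} {φ : A ⟶ A} {φ' : A' ⟶ A'} {φ'' : A'' ⟶ A''}
    {n d : ℕ} (hW : IsWeilType A φ n d) (hW' : IsWeilType A' φ' n d) (hW'' : IsWeilType A'' φ'' n d)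
    (e : ProjectiveEmbedding A.X) {a : complexBetti (projectiveSpace e.n ℂ) 2} (haQ : IsRationalClass a)
    (ha0 : a ≠ 0) (e' : ProjectiveEmbedding A'.X) {a' : complexBetti (projectiveSpace e'.n ℂ) 2}
    (ha'Q : IsRationalClass a') (ha'0 : a' ≠ 0) (e'' : ProjectiveEmbedding A''.X)
    {a'' : complexBetti (projectiveSpace e''.n ℂ) 2} (ha''Q : IsRationalClass a'') (ha''0 : a'' ≠ 0)
    (h₁ : Motives.IsWeilSimilar n A φ
      ((d : ℂ) • complexBetti.map e.ι 2 a + complexBetti.map φ.hom.hom.hom 2 (complexBetti.map e.ι 2 a)) A' φ'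
      ((d : ℂ) • complexBetti.map e'.ι 2 a' + complexBetti.map φ'.hom.hom.hom 2 (complexBetti.map e'.ι 2 a')))
    (h₂ : Motives.IsWeilSimilar n A' φ'
      ((d : ℂ) • complexBetti.map e'.ι 2 a' + complexBetti.map φ'.hom.hom.hom 2 (complexBetti.map e'.ι 2 a')) A'' φ''
      ((d : ℂ) • complexBetti.map e''.ι 2 a'' + complexBetti.map φ''.hom.hom.hom 2 (complexBetti.map e''.ι 2 a''))) :
    Motives.IsWeilSimilar n A φ
      ((d : ℂ) • complexBetti.map e.ι 2 a + complexBetti.map φ.hom.hom.hom 2 (complexBetti.map e.ι 2 a)) A'' φ''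
      ((d : ℂ) • complexBetti.map e''.ι 2 a'' + complexBetti.map φ''.hom.hom.hom 2 (complexBetti.map e''.ι 2 a'')) := by
  obtain ⟨δ, hδ⟩ := exists_hasWeilDiscriminantNondeg hW.pos hW.dim_eq hW.d_pos hW.sq_eq e haQ ha0
  obtain ⟨δ', hδ'⟩ := exists_hasWeilDiscriminantNondeg hW'.pos hW'.dim_eq hW'.d_pos hW'.sq_eq e' ha'Q ha'0
  obtain ⟨δ'', hδ''⟩ := exists_hasWeilDiscriminantNondeg hW''.pos hW''.dim_eq hW''.d_pos hW''.sq_eq e'' ha''Q ha''0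
  have h12 : δ = δ' := (isWeilSimilar_iff_weilDiscriminantClass_eq hW hW' e haQ ha0 e' ha'Q ha'0 hδ hδ').1 h₁
  have h23 : δ' = δ'' := (isWeilSimilar_iff_weilDiscriminantClass_eq hW' hW'' e' ha'Q ha'0 e'' ha''Q ha''0 hδ' hδ'').1 h₂
  exact (isWeilSimilar_iff_weilDiscriminantClass_eq hW hW'' e haQ ha0 e'' ha''Q ha''0 hδ hδ'').2 (h12.trans h23)

/-! ### §3 Cell membership is similarity-invariant: how hweil's door-B′ output files the seat's nodes -/

/-- **A Bloch seed on any triple Weil-similar to a member of the cell `δ` is a seed IN the cell `δ`** (files N80):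
`(P, ψ₀, h_K(e, a))` of Weil type with a non-zero rational Weil class `w` and a Bloch seed for `q·h_Kⁿ + w`,
Weil-similar to some `(A, φ, h_A)` (`dim A = 2n`, any polarization class) carrying a witness of class `δ` — by
transport (§1, along the symmetric similarity) `(P, ψ₀, h_K)` itself carries a witness of class `δ`.
[cite: Bloch1972Semiregularity, Thm. (7.4) and Remark (7.5)] [cite: BuchweitzFlenner2003, Thm. 5.2]
[cite: vanGeemen1994HodgeAV, Lemma 5.2 (3)] -/
theorem hasBlochSeedInClass_of_similar_member {P A : AbelianVariety ℂ} {ψ₀ : P ⟶ P} {φ : A ⟶ A} {n d : ℕ}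
    (hW : IsWeilType P ψ₀ n d) (e : ProjectiveEmbedding P.X) {a : complexBetti (projectiveSpace e.n ℂ) 2}
    (haQ : IsRationalClass a) (ha0 : a ≠ 0) {w : complexBetti P.X (2 * n)} (hwW : w ∈ weilClassesOf P ψ₀ n d)
    (hwQ : IsRationalClass w) (hw0 : w ≠ 0)
    (hseed : HasBlochSeedAt n P
      ((d : ℂ) • complexBetti.map e.ι 2 a + complexBetti.map ψ₀.hom.hom.hom 2 (complexBetti.map e.ι 2 a)) w)
    {hA : complexBetti A.X 2} (hAdim : A.dim = 2 * n)
    (hsim : Motives.IsWeilSimilar n P ψ₀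
      ((d : ℂ) • complexBetti.map e.ι 2 a + complexBetti.map ψ₀.hom.hom.hom 2 (complexBetti.map e.ι 2 a)) A φ hA)
    {δ : weilNormResidueGroup d} (hδ : HasWeilDiscriminantNondeg A φ n d hA δ) : HasBlochSeedInClass n d δ :=
  hasBlochSeedInClass_of_member hW e haQ ha0
    (hasWeilDiscriminantNondeg_of_isWeilSimilar hW.pos hAdim hW.dim_eq hsim.symm hδ) hwW hwQ hw0 hseed

/-- **A locally algebraic anchor on any triple Weil-similar to a member of the cell `δ` is an anchor IN the cell
`δ`** (files N77), by the same transport. [cite: Deligne1982HodgeCycles, proof of Thm. 4.8]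
[cite: Schoen1998HodgeWeilAddendum, §10] [cite: vanGeemen1994HodgeAV, Lemma 5.2 (3)] -/
theorem hasLocallyAlgebraicWeilAnchorInClass_of_similar_member {P A : AbelianVariety ℂ} {ψ₀ : P ⟶ P} {φ : A ⟶ A}
    {n d : ℕ} (hW : IsWeilType P ψ₀ n d) (e : ProjectiveEmbedding P.X) {a : complexBetti (projectiveSpace e.n ℂ) 2}
    (haQ : IsRationalClass a) (ha0 : a ≠ 0) {w : complexBetti P.X (2 * n)} (hwW : w ∈ weilClassesOf P ψ₀ n d)
    (hwQ : IsRationalClass w) (hw0 : w ≠ 0)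
    (hloc : WeilAnchorLocalClause n d P
      ((d : ℂ) • complexBetti.map e.ι 2 a + complexBetti.map ψ₀.hom.hom.hom 2 (complexBetti.map e.ι 2 a)) w)
    {hA : complexBetti A.X 2} (hAdim : A.dim = 2 * n)
    (hsim : Motives.IsWeilSimilar n P ψ₀
      ((d : ℂ) • complexBetti.map e.ι 2 a + complexBetti.map ψ₀.hom.hom.hom 2 (complexBetti.map e.ι 2 a)) A φ hA)
    {δ : weilNormResidueGroup d} (hδ : HasWeilDiscriminantNondeg A φ n d hA δ) :
    HasLocallyAlgebraicWeilAnchorInClass n d δ :=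
  hasLocallyAlgebraicWeilAnchorInClass_of_member hW e haQ ha0
    (hasWeilDiscriminantNondeg_of_isWeilSimilar hW.pos hAdim hW.dim_eq hsim.symm hδ) hwW hwQ hw0 hloc

/-! ### §4 The exact re-indexing of hweil's door B′ by cells -/

/-- **hweil's `HasSimilarBlochSeeds n d` ⟺ "every target has SOME `K`-symmetrised polarization whose cell
satisfies N80"** (`n, d ≥ 1`).  `⟹`: B′ hands a target `(A, φ)` a polarization `(e_A, a_A)` and a seed member
`(P, ψ₀, h_K(e, a), w)` similar to `(A, φ, h_K(e_A, a_A))`; `P` is of Weil type (a non-zero `(n,n)` Weil class,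
Deligne–Milne 4.4), so `(P, ψ₀, h_K(e, a))` has a witness class `δ` (van Geemen 5.2 (1)–(3)), transported to
`(A, φ, h_K(e_A, a_A))` by §1, and the seed files N80 `δ` (part 10).  `⟸`: the target is of Weil type, so the
class `δ` of its chosen polarization has sign `(-1)ⁿ` (5.2 (4)); N80 `δ` supplies a seed member of class `δ`,
Weil-similar to the target by part 8g (same class ⟹ similar).  So B′ is EXACTLY the per-target,
some-polarization form of N80; the seat's `∀ δ, N80 δ` implies it (part 10, W70) and differs from it only in
WHICH polarizations' cells must carry a seed. [cite: Bloch1972Semiregularity, Remark (7.5)]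
[cite: vanGeemen1994HodgeAV, Lemma 5.2 (1)–(4)] [cite: Deligne1982HodgeCycles, Prop. 4.4 and proof of Thm. 4.8]
[cite: Schoen1998HodgeWeilAddendum, §10] -/
theorem hasSimilarBlochSeeds_iff_exists_polarization_seedInClass {n d : ℕ} (hn : 0 < n) (hd : 0 < d) :
    HasSimilarBlochSeeds n d ↔
      ∀ (A : AbelianVariety ℂ) (φ : A ⟶ A), A.dim = 2 * n → φ ≫ φ = -(d • 𝟙 A) →
        (∃ wA : complexBetti A.X (2 * n),
          wA ∈ weilClassesOf A φ n d ∧ wA ≠ 0 ∧ IsOfHodgeType (2 * n) A.X (2 * n) n n wA) →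
        ∃ (eA : ProjectiveEmbedding A.X) (aA : complexBetti (projectiveSpace eA.n ℂ) 2) (δ : weilNormResidueGroup d),
          IsRationalClass aA ∧ aA ≠ 0 ∧
          HasWeilDiscriminantNondeg A φ n d
            ((d : ℂ) • complexBetti.map eA.ι 2 aA + complexBetti.map φ.hom.hom.hom 2 (complexBetti.map eA.ι 2 aA)) δ ∧
          HasBlochSeedInClass n d δ := by
  refine ⟨fun h A φ hA hφ hWA => ?_, fun h A φ hA hφ hWA => ?_⟩
  · obtain ⟨eA, aA, P, ψ₀, e, a, w, haA, haA0, hPdim, hψ, ha, ha0, hwW, hwQ, hw0, hwH, hseed, hsim⟩ :=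
      h A φ hA hφ hWA
    have hWP : IsWeilType P ψ₀ n d := isWeilType_of_weilClass_ne_zero hn hd hPdim hψ hwW hw0 hwH
    obtain ⟨δ, hδP⟩ := exists_hasWeilDiscriminantNondeg hn hPdim hd hψ e ha ha0
    exact ⟨eA, aA, δ, haA, haA0, hasWeilDiscriminantNondeg_of_isWeilSimilar hn hPdim hA hsim hδP,
      hasBlochSeedInClass_of_member hWP e ha ha0 hδP hwW hwQ hw0 hseed⟩
  · obtain ⟨wA, hwA, hwA0, hwAH⟩ := hWA
    have hW : IsWeilType A φ n d := isWeilType_of_weilClass_ne_zero hn hd hA hφ hwA hwA0 hwAH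
    obtain ⟨eA, aA, δ, haA, haA0, hδA, hS⟩ := h A φ hA hφ ⟨wA, hwA, hwA0, hwAH⟩
    obtain ⟨P, ψ₀, e, a, w, hPdim, hψ, ha, ha0, hwW, hwQ, hw0, hwH, hseed, hδP⟩ :=
      hS (weilSign_eq_of_hasWeilDiscriminantNondeg hW eA haA haA0 hδA)
    have hWP : IsWeilType P ψ₀ n d := isWeilType_of_weilClass_ne_zero hn hd hPdim hψ hwW hw0 hwH
    exact ⟨eA, aA, P, ψ₀, e, a, w, haA, haA0, hPdim, hψ, ha, ha0, hwW, hwQ, hw0, hwH, hseed,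
      isWeilSimilar_of_hasWeilDiscriminantNondeg hWP hW e ha ha0 eA haA haA0 hδP hδA⟩

/-- **hweil's `HasSimilarLocallyAlgebraicWeilAnchors n d` ⟺ "every target has SOME `K`-symmetrised polarization
whose cell satisfies N77"** (`n, d ≥ 1`) — the anchor form of the previous theorem (door B′ itself, not its seed
feed). [cite: Deligne1982HodgeCycles, Prop. 4.4 and proof of Thm. 4.8] [cite: Schoen1998HodgeWeilAddendum, §10]
[cite: vanGeemen1994HodgeAV, Lemma 5.2 (1)–(4)] -/
theorem hasSimilarLocallyAlgebraicWeilAnchors_iff_exists_polarization_anchorInClass {n d : ℕ} (hn : 0 < n)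
    (hd : 0 < d) :
    HasSimilarLocallyAlgebraicWeilAnchors n d ↔
      ∀ (A : AbelianVariety ℂ) (φ : A ⟶ A), A.dim = 2 * n → φ ≫ φ = -(d • 𝟙 A) →
        (∃ wA : complexBetti A.X (2 * n),
          wA ∈ weilClassesOf A φ n d ∧ wA ≠ 0 ∧ IsOfHodgeType (2 * n) A.X (2 * n) n n wA) →
        ∃ (eA : ProjectiveEmbedding A.X) (aA : complexBetti (projectiveSpace eA.n ℂ) 2) (δ : weilNormResidueGroup d),
          IsRationalClass aA ∧ aA ≠ 0 ∧
          HasWeilDiscriminantNondeg A φ n d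
            ((d : ℂ) • complexBetti.map eA.ι 2 aA + complexBetti.map φ.hom.hom.hom 2 (complexBetti.map eA.ι 2 aA)) δ ∧
          HasLocallyAlgebraicWeilAnchorInClass n d δ := by
  refine ⟨fun h A φ hA hφ hWA => ?_, fun h A φ hA hφ hWA => ?_⟩
  · obtain ⟨eA, aA, P, ψ₀, e, a, w, haA, haA0, hPdim, hψ, ha, ha0, hwW, hwQ, hw0, hwH, hloc, hsim⟩ :=
      h A φ hA hφ hWA
    have hWP : IsWeilType P ψ₀ n d := isWeilType_of_weilClass_ne_zero hn hd hPdim hψ hwW hw0 hwH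
    obtain ⟨δ, hδP⟩ := exists_hasWeilDiscriminantNondeg hn hPdim hd hψ e ha ha0
    exact ⟨eA, aA, δ, haA, haA0, hasWeilDiscriminantNondeg_of_isWeilSimilar hn hPdim hA hsim hδP,
      hasLocallyAlgebraicWeilAnchorInClass_of_member hWP e ha ha0 hδP hwW hwQ hw0 hloc⟩
  · obtain ⟨wA, hwA, hwA0, hwAH⟩ := hWA
    have hW : IsWeilType A φ n d := isWeilType_of_weilClass_ne_zero hn hd hA hφ hwA hwA0 hwAH
    obtain ⟨eA, aA, δ, haA, haA0, hδA, hN⟩ := h A φ hA hφ ⟨wA, hwA, hwA0, hwAH⟩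
    obtain ⟨P, ψ₀, e, a, w, hPdim, hψ, ha, ha0, hwW, hwQ, hw0, hwH, hloc, hδP⟩ :=
      hN (weilSign_eq_of_hasWeilDiscriminantNondeg hW eA haA haA0 hδA)
    have hWP : IsWeilType P ψ₀ n d := isWeilType_of_weilClass_ne_zero hn hd hPdim hψ hwW hw0 hwH
    exact ⟨eA, aA, P, ψ₀, e, a, w, haA, haA0, hPdim, hψ, ha, ha0, hwW, hwQ, hw0, hwH, hloc,
      isWeilSimilar_of_hasWeilDiscriminantNondeg hWP hW e ha ha0 eA haA haA0 hδP hδA⟩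

/- Remark (no declaration; the gate's dedup rule): the composite `∀ δ, N80 δ ⟹ per-target form ⟹ B′` through
the equivalence above has literally the type of part 10's landed W70
`hasSimilarBlochSeeds_of_seedInClass (hn) (hd) (h : ∀ δ, HasBlochSeedInClass n d δ) : HasSimilarBlochSeeds n d`
(`Theorems/Ring2AbelianAllWeilCellsBlochSeed.lean`), which is the declaration to cite; it is not restated here. -/

end Summit.HodgeConjecture.HodgeConjecture.Ring2.AbelianAll

end
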